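import Literature.Geometry.Symplectic.GromovR4RelEndProofs
import Literature.Topology.FourManifolds.RadialExtension

/-!
# Stub `stub_coneRelEnd` of line `contact-isotopy-gromov-cone` for crux `SchoenfliesSplit.SchsplitCerf` (stmt-SmoothPoincare4-8758)

Gromov packaging (Z2).  For `ψ ∈ Diff S³`, `h > 0` smooth on `S³` and the rescaled cone
`C(y) = ‖y‖ · h(ŷ) · ψ(ŷ)` (`ŷ = radialProjection y`), assumed `C^∞` and `ω₀`-symplectic off the
origin, the named fact `Literature.Geometry.Symplectic.gromov_recognitionR4_relEnd`
(McDuff–Salamon 2017, Rem. 4.5.2 (viii)) applied to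
`(M, sf, K, R, ψ, χ) := (ℝ⁴, ω₀, {‖C x‖ ≤ 1}, 1, C, cone of (ψ⁻¹, 1/(h ∘ ψ⁻¹)))`
returns a diffeomorphism `Φ` of `ℝ⁴` equal to `C` off a compact set.  Hypotheses 1–4 of the fact
are `gromov_recognitionR4_relEnd.stdModel_hypotheses` (`π₂(ℝ⁴) = 0`, `ω₀` smooth, closed,
nondegenerate); the ends clause: `‖C x‖ = ‖x‖ h(x̂) ≥ ‖x‖ · min h`, and `C` is continuous (at `0`
by `‖C y‖ ≤ max h · ‖y‖`), so `{‖C x‖ ≤ R'}` is closed and bounded; `C`, `χ` are `C^∞` off `0`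
(`contMDiffAt_radialProjection`); `BijOn` from the explicit two-sided inverse `χ`; the pull-back
clause is the symplectic hypothesis read through `mfderiv = fderiv` and `stdSymplecticMForm_apply`.
Only the diffeomorphism half of the fact's conclusion is exported.
-/

noncomputable section

-- the prescribed namespace `Summit.<P>.<Sub>.…` duplicates `SmoothPoincare4` (P = Sub)
set_option linter.dupNamespace false

open scoped Manifold ContDiff Topology
open Set Function Metric
open Literature.Topology.FourManifolds Literature.Geometry.Symplectic

namespace Summit.SmoothPoincare4.SmoothPoincare4.Theorems.SchsplitCerf.ContactIsotopyGromovCone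

attribute [local instance] Literature.Topology.FourManifolds.fact_finrank_euclideanSpace_succ

/-- The unit 3-sphere. -/
local notation "𝕊³" => (Metric.sphere (0 : EuclideanSpace ℝ (Fin 4)) 1)
/-- The model `ℝ⁴`. -/
local notation "E4" => EuclideanSpace ℝ (Fin 4)

namespace ConeRelEnd

variable {ψ : 𝕊³ ≃ₘ⟮𝓡 3, 𝓡 3⟯ 𝕊³} {h : 𝕊³ → ℝ} {C χ : E4 → E4} {p : 𝕊³}

/-- `‖C y‖ = ‖y‖ · h ŷ` for the rescaled cone `C(y) = ‖y‖ h(ŷ) ψ(ŷ)` with `h > 0`. [folklore] -/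
theorem norm_cone (hpos : ∀ z, 0 < h z)
    (hC : ∀ y : E4, C y =
      (‖y‖ * h (radialProjection p y)) • ((ψ (radialProjection p y) : 𝕊³) : E4)) (y : E4) :
    ‖C y‖ = ‖y‖ * h (radialProjection p y) := by
  rw [hC]
  exact norm_smul_coe_sphere (mul_nonneg (norm_nonneg _) (hpos _).le) _

/-- The rescaled cone fixes the origin. [folklore] -/
theorem cone_zero
    (hC : ∀ y : E4, C y =
      (‖y‖ * h (radialProjection p y)) • ((ψ (radialProjection p y) : 𝕊³) : E4)) :
    C 0 = 0 := by
  rw [hC, norm_zero, zero_mul, zero_smul]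

/-- A point whose image under the cone has norm `> 1` is not the origin. [folklore] -/
theorem ne_zero_of_one_lt
    (hC : ∀ y : E4, C y =
      (‖y‖ * h (radialProjection p y)) • ((ψ (radialProjection p y) : 𝕊³) : E4)) {x : E4}
    (hx : 1 < ‖C x‖) : x ≠ 0 := by
  rintro rfl
  rw [cone_zero hC, norm_zero] at hx
  exact absurd hx (not_lt.2 zero_le_one)

/-- The inverse cone `χ(y) = (‖y‖ / h(ψ⁻¹ ŷ)) ψ⁻¹(ŷ)` is a right inverse of the cone off the
origin: `C (χ y) = y`. [folklore] -/
theorem cone_inv (hpos : ∀ z, 0 < h z)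
    (hC : ∀ y : E4, C y =
      (‖y‖ * h (radialProjection p y)) • ((ψ (radialProjection p y) : 𝕊³) : E4))
    (hχ : ∀ y : E4, χ y =
      (‖y‖ / h (ψ.symm (radialProjection p y))) •
        ((ψ.symm (radialProjection p y) : 𝕊³) : E4)) {y : E4} (hy : y ≠ 0) :
    C (χ y) = y := by
  have hc : 0 < ‖y‖ / h (ψ.symm (radialProjection p y)) := div_pos (norm_pos_iff.2 hy) (hpos _)
  have hπ : radialProjection p (χ y) = ψ.symm (radialProjection p y) := by
    rw [hχ]
    exact radialProjection_smul p hc _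
  have hn : ‖χ y‖ = ‖y‖ / h (ψ.symm (radialProjection p y)) := by
    rw [hχ]
    exact norm_smul_coe_sphere hc.le _
  rw [hC (χ y), hπ, hn, div_mul_cancel₀ _ (hpos _).ne', Diffeomorph.apply_symm_apply]
  exact norm_smul_coe_radialProjection p y

/-- The inverse cone is a left inverse of the cone off the origin: `χ (C x) = x`. [folklore] -/
theorem inv_cone (hpos : ∀ z, 0 < h z)
    (hC : ∀ y : E4, C y =
      (‖y‖ * h (radialProjection p y)) • ((ψ (radialProjection p y) : 𝕊³) : E4))
    (hχ : ∀ y : E4, χ y =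
      (‖y‖ / h (ψ.symm (radialProjection p y))) •
        ((ψ.symm (radialProjection p y) : 𝕊³) : E4)) {x : E4} (hx : x ≠ 0) :
    χ (C x) = x := by
  have hc : 0 < ‖x‖ * h (radialProjection p x) := mul_pos (norm_pos_iff.2 hx) (hpos _)
  have hπ : radialProjection p (C x) = ψ (radialProjection p x) := by
    rw [hC]
    exact radialProjection_smul p hc _
  rw [hχ (C x), hπ, norm_cone hpos hC x, Diffeomorph.symm_apply_apply,
    mul_div_cancel_right₀ _ (hpos _).ne']
  exact norm_smul_coe_radialProjection p x

/-- The cone is `C^∞` away from the origin (every constituent is: `‖·‖` off `0`, the radial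
projection into Mathlib's manifold `S³` off `0`, `h`, `ψ` and the inclusion `S³ ↪ ℝ⁴`).
[folklore] -/
theorem contDiffAt_cone (hh : ContMDiff (𝓡 3) 𝓘(ℝ, ℝ) ∞ h)
    (hC : ∀ y : E4, C y = (‖y‖ * h (radialProjection p y)) • ((ψ (radialProjection p y) : 𝕊³) : E4))
    {y : E4} (hy : y ≠ 0) : ContDiffAt ℝ ∞ C y := by
  have h1 : ContMDiffAt 𝓘(ℝ, E4) (𝓡 3) ∞ (fun x : E4 => ψ (radialProjection p x)) y :=
    ψ.contMDiff.contMDiffAt.comp y (contMDiffAt_radialProjection p hy)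
  have h2 : ContMDiffAt 𝓘(ℝ, E4) 𝓘(ℝ, ℝ) ∞ (fun x : E4 => h (radialProjection p x)) y :=
    hh.contMDiffAt.comp y (contMDiffAt_radialProjection p hy)
  have h3 : ContMDiffAt 𝓘(ℝ, E4) 𝓘(ℝ, E4) ∞
      (fun x : E4 => ((ψ (radialProjection p x) : 𝕊³) : E4)) y :=
    contMDiff_coe_sphere.contMDiffAt.comp y h1
  have hC' : C = fun x : E4 =>
      (‖x‖ * h (radialProjection p x)) • ((ψ (radialProjection p x) : 𝕊³) : E4) := funext hC
  rw [hC']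
  exact ((contDiffAt_norm ℝ hy).mul (contMDiffAt_iff_contDiffAt.1 h2)).smul
    (contMDiffAt_iff_contDiffAt.1 h3)

/-- The inverse cone is `C^∞` away from the origin (every constituent is: `‖·‖` off `0`, the
radial projection into Mathlib's manifold `S³` off `0`, `h`, `ψ⁻¹` and the inclusion
`S³ ↪ ℝ⁴`; `h > 0` for the division). [folklore] -/
theorem contDiffAt_inv (hh : ContMDiff (𝓡 3) 𝓘(ℝ, ℝ) ∞ h) (hpos : ∀ z, 0 < h z)
    (hχ : ∀ y : E4, χ y =
      (‖y‖ / h (ψ.symm (radialProjection p y))) •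
        ((ψ.symm (radialProjection p y) : 𝕊³) : E4)) {y : E4} (hy : y ≠ 0) :
    ContDiffAt ℝ ∞ χ y := by
  have h1 : ContMDiffAt 𝓘(ℝ, E4) (𝓡 3) ∞ (fun x : E4 => ψ.symm (radialProjection p x)) y :=
    ψ.symm.contMDiff.contMDiffAt.comp y (contMDiffAt_radialProjection p hy)
  have h2 : ContMDiffAt 𝓘(ℝ, E4) 𝓘(ℝ, ℝ) ∞
      (fun x : E4 => h (ψ.symm (radialProjection p x))) y :=
    hh.contMDiffAt.comp y h1
  have h3 : ContMDiffAt 𝓘(ℝ, E4) 𝓘(ℝ, E4) ∞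
      (fun x : E4 => ((ψ.symm (radialProjection p x) : 𝕊³) : E4)) y :=
    contMDiff_coe_sphere.contMDiffAt.comp y h1
  have h4 : ContDiffAt ℝ ∞ (fun x : E4 =>
      (‖x‖ / h (ψ.symm (radialProjection p x))) •
        ((ψ.symm (radialProjection p x) : 𝕊³) : E4)) y :=
    ((contDiffAt_norm ℝ hy).div (contMDiffAt_iff_contDiffAt.1 h2) (hpos _).ne').smul
      (contMDiffAt_iff_contDiffAt.1 h3)
  have hχ' : χ = fun x : E4 =>
      (‖x‖ / h (ψ.symm (radialProjection p x))) •
        ((ψ.symm (radialProjection p x) : 𝕊³) : E4) := funext hχ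
  rw [hχ']
  exact h4

/-- The rescaled cone is continuous on all of `ℝ⁴` when it is `C^∞` off the origin: at the
origin `‖C y‖ = ‖y‖ h(ŷ) ≤ (max h) ‖y‖ → 0`. [folklore] -/
theorem continuous_cone (hh : ContMDiff (𝓡 3) 𝓘(ℝ, ℝ) ∞ h) (hpos : ∀ z, 0 < h z)
    (hC : ∀ y : E4, C y =
      (‖y‖ * h (radialProjection p y)) • ((ψ (radialProjection p y) : 𝕊³) : E4))
    (hCs : ∀ x : E4, x ≠ 0 → ContDiffAt ℝ ∞ C x) : Continuous C := by
  rw [continuous_iff_continuousAt]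
  intro x
  by_cases hx : x = 0
  · subst hx
    obtain ⟨M, hM⟩ : ∃ M : ℝ, ∀ z, h z ≤ M := by
      obtain ⟨z₀, -, hz₀⟩ :=
        isCompact_univ.exists_isMaxOn ⟨p, mem_univ p⟩ hh.continuous.continuousOn
      exact ⟨h z₀, fun z => hz₀ (mem_univ z)⟩
    rw [ContinuousAt, cone_zero hC]
    refine squeeze_zero_norm (a := fun y : E4 => M * ‖y‖) (fun y => ?_) ?_
    · rw [norm_cone hpos hC, mul_comm]
      exact mul_le_mul_of_nonneg_right (hM _) (norm_nonneg _)
    · have ht := (tendsto_norm_zero (E := E4)).const_mul M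
      rwa [mul_zero] at ht
  · exact (hCs x hx).continuousAt

/-- The sub-level sets `{‖C x‖ ≤ R}` of the rescaled cone are compact: closed by continuity of
`C`, bounded by `B̄(0, R / min h)` since `‖C x‖ = ‖x‖ h(x̂) ≥ ‖x‖ · min h`. [folklore] -/
theorem isCompact_setOf_norm_cone_le (hh : ContMDiff (𝓡 3) 𝓘(ℝ, ℝ) ∞ h) (hpos : ∀ z, 0 < h z)
    (hC : ∀ y : E4, C y =
      (‖y‖ * h (radialProjection p y)) • ((ψ (radialProjection p y) : 𝕊³) : E4))
    (hCs : ∀ x : E4, x ≠ 0 → ContDiffAt ℝ ∞ C x) (R : ℝ) :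
    IsCompact {x : E4 | ‖C x‖ ≤ R} := by
  obtain ⟨m, hm, hmle⟩ : ∃ m : ℝ, 0 < m ∧ ∀ z, m ≤ h z := by
    obtain ⟨z₀, -, hz₀⟩ :=
      isCompact_univ.exists_isMinOn ⟨p, mem_univ p⟩ hh.continuous.continuousOn
    exact ⟨h z₀, hpos z₀, fun z => hz₀ (mem_univ z)⟩
  refine Metric.isCompact_of_isClosed_isBounded
    (isClosed_le (continuous_norm.comp (continuous_cone hh hpos hC hCs)) continuous_const) ?_
  rw [isBounded_iff_forall_norm_le]
  refine ⟨R / m, fun x hx => ?_⟩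
  rw [le_div_iff₀ hm]
  calc ‖x‖ * m ≤ ‖x‖ * h (radialProjection p x) :=
        mul_le_mul_of_nonneg_left (hmle _) (norm_nonneg _)
    _ = ‖C x‖ := (norm_cone hpos hC x).symm
    _ ≤ R := hx

end ConeRelEnd

/-- **Stub Z2 — Gromov packaging: a symplectic cone is an end of `(ℝ⁴, ω₀)` standard at infinity,
so the named fact returns a diffeomorphism of `ℝ⁴` equal to the cone off a compact set.**
Apply `gromov_recognitionR4_relEnd` to `M := ℝ⁴`, `sf := stdSymplecticMForm` (hypotheses 1–4 =
`gromov_recognitionR4_relEnd.stdModel_hypotheses`: `π₂(ℝ⁴) = 0`, `ω₀` smooth, closed,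
nondegenerate), `R := 1`, `K := {x | ‖C x‖ ≤ 1}` (the sub-level sets `{‖C x‖ ≤ R'}` are compact:
`‖C x‖ = ‖x‖ h(x̂)` with `0 < min h ≤ h ≤ max h` on the compact `S³` — the ENDS clause), `ψ := C`
(`C^∞` on `Kᶜ ⊆ ℝ⁴ ∖ 0`: `ConeRelEnd.contDiffAt_cone`), `χ :=` the cone of `(ψ⁻¹, 1/(h ∘ ψ⁻¹))` (the explicit
inverse, `C^∞` off `0 ∉ B̄(0,1)ᶜ`), `BijOn C Kᶜ B̄(0,1)ᶜ` and `χ ∘ C = id` on `Kᶜ` by the two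
inverse identities, and the pull-back clause `ω₀ = C^*ω₀` on `Kᶜ` from the symplectic hypothesis
(`mfderiv = fderiv` on the model space, `stdSymplecticMForm_apply`).  Output: the fact's `Φ` and
`K'` (its symplectic clause is dropped). [cite: McDuffSalamon2017, Rem. 4.5.2 (viii)] -/
theorem stub_coneRelEnd :
    gromov_recognitionR4_relEnd →
    ∀ (ψ : 𝕊³ ≃ₘ⟮𝓡 3, 𝓡 3⟯ 𝕊³) (h : 𝕊³ → ℝ) (C : E4 → E4),
      ContMDiff (𝓡 3) 𝓘(ℝ, ℝ) ∞ h → (∀ z, 0 < h z) →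
      (∀ y : E4, C y =
        (‖y‖ * h (radialProjection (sphereBasePoint 3) y)) •
          ((ψ (radialProjection (sphereBasePoint 3) y) : 𝕊³) : E4)) →
      (∀ x : E4, x ≠ 0 → ∀ v w : E4,
        stdSymplecticForm (fderiv ℝ C x v) (fderiv ℝ C x w) = stdSymplecticForm v w) →
      ∃ Φ : E4 ≃ₘ⟮𝓡 4, 𝓡 4⟯ E4, ∃ K' : Set E4, IsCompact K' ∧ ∀ x, x ∉ K' → Φ x = C x := by
  intro hG ψ h C hh hpos hC hsymp
  -- the cone is smooth off the origin
  have hCs : ∀ x : E4, x ≠ 0 → ContDiffAt ℝ ∞ C x := fun x hx =>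
    ConeRelEnd.contDiffAt_cone hh hC hx
  -- the explicit inverse of the cone off the origin
  set χ : E4 → E4 := fun y =>
    (‖y‖ / h (ψ.symm (radialProjection (sphereBasePoint 3) y))) •
      ((ψ.symm (radialProjection (sphereBasePoint 3) y) : 𝕊³) : E4)
  have hχ : ∀ y : E4, χ y =
      (‖y‖ / h (ψ.symm (radialProjection (sphereBasePoint 3) y))) •
        ((ψ.symm (radialProjection (sphereBasePoint 3) y) : 𝕊³) : E4) := fun y => rfl
  -- the compact `K` and the two ends `Kᶜ`, `B̄(0, 1)ᶜ`
  set K : Set E4 := {x | ‖C x‖ ≤ 1} with hK_def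
  have hmemKc : ∀ x : E4, x ∈ Kᶜ ↔ 1 < ‖C x‖ := fun x => by
    rw [hK_def, mem_compl_iff, mem_setOf_eq, not_le]
  have hKc0 : ∀ x : E4, x ∈ Kᶜ → x ≠ 0 := fun x hx =>
    ConeRelEnd.ne_zero_of_one_lt hC ((hmemKc x).1 hx)
  have hmemT : ∀ y : E4, y ∈ (closedBall (0 : E4) 1)ᶜ ↔ 1 < ‖y‖ := fun y => by
    rw [mem_compl_iff, mem_closedBall_zero_iff, not_le]
  have hT0 : ∀ y : E4, y ∈ (closedBall (0 : E4) 1)ᶜ → y ≠ 0 := fun y hy => by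
    rw [← norm_pos_iff]
    exact one_pos.trans ((hmemT y).1 hy)
  -- hypotheses 1–4: the standard model
  obtain ⟨h₁, h₂, h₃, h₄, -, -, -, -, -, -⟩ := gromov_recognitionR4_relEnd.stdModel_hypotheses
  -- hypothesis 5: the ends clause
  have h₅ : ∀ R', (1 : ℝ) ≤ R' → IsCompact (K ∪ {x : E4 | ‖C x‖ ≤ R'}) := fun R' _ =>
    (ConeRelEnd.isCompact_setOf_norm_cone_le hh hpos hC hCs 1).union
      (ConeRelEnd.isCompact_setOf_norm_cone_le hh hpos hC hCs R')
  -- hypotheses 6, 7: smoothness of `C` on `Kᶜ` and of `χ` on `B̄(0, 1)ᶜ`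
  have h₆ : ContMDiffOn (𝓡 4) 𝓘(ℝ, E4) ∞ C Kᶜ := fun x hx =>
    (hCs x (hKc0 x hx)).contMDiffAt.contMDiffWithinAt
  have h₇ : ContMDiffOn 𝓘(ℝ, E4) (𝓡 4) ∞ χ (closedBall (0 : E4) 1)ᶜ := fun y hy =>
    (ConeRelEnd.contDiffAt_inv hh hpos hχ (hT0 y hy)).contMDiffAt.contMDiffWithinAt
  -- hypotheses 8, 9: `C` is a bijection of the ends with inverse `χ`
  have h₉ : ∀ x : E4, x ∈ Kᶜ → χ (C x) = x := fun x hx =>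
    ConeRelEnd.inv_cone hpos hC hχ (hKc0 x hx)
  have h₈ : BijOn C Kᶜ (closedBall (0 : E4) 1)ᶜ := by
    refine Set.InvOn.bijOn ⟨h₉, fun y hy => ConeRelEnd.cone_inv hpos hC hχ (hT0 y hy)⟩ ?_ ?_
    · intro x hx
      rw [hmemT]
      exact (hmemKc x).1 hx
    · intro y hy
      rw [hmemKc, ConeRelEnd.cone_inv hpos hC hχ (hT0 y hy)]
      exact (hmemT y).1 hy
  -- hypothesis 10: the pull-back clause `ω₀ = C^*ω₀` on `Kᶜ`
  have h₁₀ : ∀ x : E4, x ∈ Kᶜ → ∀ v w : TangentSpace (𝓡 4) x, stdSymplecticMForm x ![v, w] =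
      stdSymplecticForm (mfderiv (𝓡 4) 𝓘(ℝ, E4) C x v) (mfderiv (𝓡 4) 𝓘(ℝ, E4) C x w) := by
    intro x hx v w
    have hD : mfderiv (𝓡 4) 𝓘(ℝ, E4) C x = fderiv ℝ C x := mfderiv_eq_fderiv
    rw [stdSymplecticMForm_apply, hD]
    exact (hsymp x (hKc0 x hx) v w).symm
  -- apply the named fact and drop the symplectic clause of its conclusion
  obtain ⟨Φ, -, K', hK', hΦ⟩ :=
    hG E4 stdSymplecticMForm K 1 C χ h₁ h₂ h₃ h₄ h₅ h₆ h₇ h₈ h₉ h₁₀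
  exact ⟨Φ, K', hK', hΦ⟩

end Summit.SmoothPoincare4.SmoothPoincare4.Theorems.SchsplitCerf.ContactIsotopyGromovCone

end
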